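import Mathlib
import HarnessLib
import Summits.HubbardSuperconductivity.HubbardSuperconductivity.Theorems.KLProgrammeKLRegimeTwoVolumeSourceSmoothCommute
import Summits.HubbardSuperconductivity.HubbardSuperconductivity.Theorems.KLProgrammeKLRegimeTwoVolumeTowerSrcScaledKit
import Summits.HubbardSuperconductivity.HubbardSuperconductivity.Theorems.KLProgrammeKLRegimeTwoVolumeTowerTruncKit

/-!
# Route `KLProgramme` — crux K3, VL child (stmt-HubbardSuperconductivity-20440), keying option «(VL)-SRC-WINDOW»: THE SMOOTHED RESCALED STATES OBEY THE
# TOWER'S RECURSION (seat hubbard-kl-k3c4-p1 g16, filed by g17 under the pen's (R235) «KEY = WINDOW») — the twin of `…TowerSrcScaledKit` §2 for `klTowerStateSW`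

`klTowerStateSW … t j = srcSmooth (klTowerStateS … t j)` (`…TwoVolumeSourceSmoothDefs`).  Since the smoothing commutes with the dead-variable steps
(`effAction_srcSmooth_comm`), with the copy-diagonal transfers (`map_klSrcTransfer_srcSmooth_comm`) and — being copy-diagonal itself — with source
truncation (`map_toLin'_srcTrunc_comm`), the smoothed rescaled states satisfy the same recursion as the rescaled ones:
* `srcSmooth_srcTrunc_comm`, `map_klTowerTransfer_srcSmooth_comm` (all `j`, the `j = 0` transfer being `1`);
* parity: `klTowerDSW_parity_of_parity`, `klTowerDSW_parity`, `srcTrunc_klTowerDSW_parity`, `klTowerStateSW_parity`;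
* **`map_klTowerTransfer_klTowerStateSW`** (`map T_j (SW-state j) = SW-D_j`), `klTowerStateSW_succ_eq_effAction_map`, **`srcTrunc_klTowerDSW_eq_map`**,
  **`srcTrunc_klTowerStateSW_succ`**.

Proofs only.  [cite: BenfattoGiulianiMastropietro2006, §2.9 (4.3)-(4.8)]
-/

noncomputable section

namespace Summit.HubbardSuperconductivity.HubbardSuperconductivity.Theorems.TwoVolumeSource

set_option linter.dupNamespace false -- summit = problem name (single-conjunct summit), D-0017

open Finset Literature.MathematicalPhysics.QuantumLattice GrassmannAlgebra Literature.Probability.LatticeModels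
  Literature.Probability.LatticeModels.BattleFederbush
open Summit.HubbardSuperconductivity.HubbardSuperconductivity.Theorems.KLRegimeSplit
open Summit.HubbardSuperconductivity.HubbardSuperconductivity.Theorems.KLProgrammeLegKernels
open Summit.HubbardSuperconductivity.HubbardSuperconductivity.Theorems.TwoVolumeDefect

variable {V M : ℕ} [NeZero V] [NeZero M]

omit [NeZero M] in
/-- **The smoothing commutes with source truncation** (it is copy-diagonal). [cite: BenfattoGiulianiMastropietro2006, §2.9 (4.3)-(4.6)] -/
theorem srcSmooth_srcTrunc_comm (n kk : ℕ) (X : GrassmannAlgebra ℂ (SrcLabel V M n)) :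
    srcSmooth V M n (srcTrunc ℂ (fun q : SrcLabel V M n => q.2 = 1) kk X) = srcTrunc ℂ (fun q : SrcLabel V M n => q.2 = 1) kk (srcSmooth V M n X) := by
  rw [srcSmooth_apply, srcSmooth_apply]
  exact map_toLin'_srcTrunc_comm (srcSmoothMat V M n) (srcSmoothMat_offDiag V M n) kk X

omit [NeZero M] in
/-- **Every transfer of the tower commutes with the smoothing**: `map T_j (srcSmooth_{j-1} X) = srcSmooth_j (map T_j X)` (`T_0 = 1`; `T_{k+1} = T⁺_k`).
[cite: Salmhofer1999, App. B.2 (B.23)-(B.25)] -/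
theorem map_klTowerTransfer_srcSmooth_comm (β μ : ℝ) (K : TrigPolyC4v) (j : ℕ) (X : GrassmannAlgebra ℂ (SrcLabel V M (j - 1))) :
    ExteriorAlgebra.map (Matrix.toLin' (klTowerTransfer V M β μ K j)) (srcSmooth V M (j - 1) X) =
      srcSmooth V M j (ExteriorAlgebra.map (Matrix.toLin' (klTowerTransfer V M β μ K j)) X) := by
  cases j with
  | zero =>
    rw [klTowerTransfer_zero, Matrix.toLin'_one, ExteriorAlgebra.map_id, AlgHom.id_apply, AlgHom.id_apply]
  | succ k =>
    rw [klTowerTransfer_succ]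
    exact map_klSrcTransfer_srcSmooth_comm β μ K k X

omit [NeZero M] in
/-- **Parity of the smoothed rescaled read-outs from the parity of the read-outs.** [folklore] -/
theorem klTowerDSW_parity_of_parity (β U μ : ℝ) (K : TrigPolyC4v) (t : ℝ) (j : ℕ)
    (h : klTowerD V M β U μ K j ∈ evenOdd ℂ 0 ∧ constPart ℂ (klTowerD V M β U μ K j) = 0) :
    klTowerDSW V M β U μ K t j ∈ evenOdd ℂ 0 ∧ constPart ℂ (klTowerDSW V M β U μ K t j) = 0 := by
  obtain ⟨he, h0⟩ := klTowerDS_parity_of_parity β U μ K t j h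
  rw [klTowerDSW_eq, srcSmooth_apply]
  exact ⟨map_mem_evenOdd_zero ℂ _ he, by rw [constPart_map]; exact h0⟩

/-- **Parity of the smoothed rescaled read-outs** (given `Z^K_{Λ_{j+1}} ≠ 0`). [folklore] -/
theorem klTowerDSW_parity (β U μ : ℝ) (K : TrigPolyC4v) (t : ℝ) (j : ℕ)
    (hZ : hubbardEffPartitionFnCT V M β U μ 0 K (klScale klE0 (j + 1)) ≠ 0) :
    klTowerDSW V M β U μ K t j ∈ evenOdd ℂ 0 ∧ constPart ℂ (klTowerDSW V M β U μ K t j) = 0 :=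
  klTowerDSW_parity_of_parity β U μ K t j (klTowerD_parity β U μ K j hZ)

/-- **Parity of the truncated smoothed rescaled read-outs.** [folklore] -/
theorem srcTrunc_klTowerDSW_parity (β U μ : ℝ) (K : TrigPolyC4v) (t : ℝ) (j kk : ℕ)
    (hZ : hubbardEffPartitionFnCT V M β U μ 0 K (klScale klE0 (j + 1)) ≠ 0) :
    srcTrunc ℂ (fun q : SrcLabel V M j => q.2 = 1) kk (klTowerDSW V M β U μ K t j) ∈ evenOdd ℂ 0 ∧
      constPart ℂ (srcTrunc ℂ (fun q : SrcLabel V M j => q.2 = 1) kk (klTowerDSW V M β U μ K t j)) = 0 := by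
  obtain ⟨he, h0⟩ := klTowerDSW_parity β U μ K t j hZ
  exact ⟨(mem_evenPart_iff).1 (srcTrunc_mem_evenPart ℂ _ kk ((mem_evenPart_iff).2 he)), constPart_srcTrunc_eq_zero ℂ _ kk h0⟩

omit [NeZero M] in
/-- **Parity of the smoothed rescaled states** from the parity of the states. [folklore] -/
theorem klTowerStateSW_parity (β U μ : ℝ) (K : TrigPolyC4v) (t : ℝ) (j : ℕ)
    (h : klTowerState V M β U μ K j ∈ evenOdd ℂ 0 ∧ constPart ℂ (klTowerState V M β U μ K j) = 0) :
    klTowerStateSW V M β U μ K t j ∈ evenOdd ℂ 0 ∧ constPart ℂ (klTowerStateSW V M β U μ K t j) = 0 := by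
  obtain ⟨he, h0⟩ := klTowerStateS_parity β U μ K t j h
  rw [klTowerStateSW_eq, srcSmooth_apply]
  exact ⟨map_mem_evenOdd_zero ℂ _ he, by rw [constPart_map]; exact h0⟩

omit [NeZero M] in
/-- **`SW-D_k = S_t (srcSmooth D_k)`** (the smoothing and the rescaling commute). [cite: BenfattoGiulianiMastropietro2006, §2.9 (4.6)-(4.8)] -/
theorem klTowerDSW_eq_srcScale_srcSmooth (β U μ : ℝ) (K : TrigPolyC4v) (t : ℝ) (k : ℕ) :
    klTowerDSW V M β U μ K t k = srcScale ℂ t (srcSmooth V M k (klTowerD V M β U μ K k)) := by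
  rw [klTowerDSW_eq, klTowerDS_eq, srcSmooth_srcScale_comm]

omit [NeZero M] in
/-- **The defining recursion survives the smoothing**: `SW-state (k+1) = effAction C⁺_k (SW-D_k)` (for the rescaled states this is `rfl`; here it is the
dead-variable commutation). [cite: BenfattoGiulianiMastropietro2006, §2.9 (4.6)-(4.8)] -/
theorem klTowerStateSW_succ (β U μ : ℝ) (K : TrigPolyC4v) (t : ℝ) (k : ℕ) :
    klTowerStateSW V M β U μ K t (k + 1) = effAction ℂ (klStepCovD V M β μ K k) (klTowerDSW V M β U μ K t k) := by
  rw [klTowerDSW_eq]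
  show srcSmooth V M k (klTowerStateS V M β U μ K t (k + 1)) = _
  rw [klTowerStateS_succ]
  exact (effAction_srcSmooth_comm (klStepCovD V M β μ K k) (klStepCovD_eq_zero_of_src β μ K k) _).symm

/-- **`map T_j (SW-state j) = SW-D_j`.** [cite: BenfattoGiulianiMastropietro2006, §2.7 (2.70)-(2.71), §2.9 (4.6)-(4.8)] -/
theorem map_klTowerTransfer_klTowerStateSW {β : ℝ} (hβ : β ≠ 0) (U μ : ℝ) (K : TrigPolyC4v) (t : ℝ) (j : ℕ)
    (hZ : ∀ k, j = k + 1 → hubbardEffPartitionFnCT V M β U μ 0 K (klScale klE0 (k + 1)) ≠ 0) :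
    ExteriorAlgebra.map (Matrix.toLin' (klTowerTransfer V M β μ K j)) (klTowerStateSW V M β U μ K t j) = klTowerDSW V M β U μ K t j := by
  rw [klTowerStateSW_eq, map_klTowerTransfer_srcSmooth_comm, map_klTowerTransfer_klTowerStateS hβ U μ K t j hZ, klTowerDSW_eq]

/-- **The step shape on the smoothed rescaled tower**: `SW-state (j+1) = effAction C⁺_j (map T_j (SW-state j))`. [folklore] -/
theorem klTowerStateSW_succ_eq_effAction_map {β : ℝ} (hβ : β ≠ 0) (U μ : ℝ) (K : TrigPolyC4v) (t : ℝ) (j : ℕ)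
    (hZ : ∀ k, j = k + 1 → hubbardEffPartitionFnCT V M β U μ 0 K (klScale klE0 (k + 1)) ≠ 0) :
    klTowerStateSW V M β U μ K t (j + 1) =
      effAction ℂ (klStepCovD V M β μ K j) (ExteriorAlgebra.map (Matrix.toLin' (klTowerTransfer V M β μ K j)) (klTowerStateSW V M β U μ K t j)) := by
  rw [map_klTowerTransfer_klTowerStateSW hβ U μ K t j hZ, klTowerDSW_eq]
  show srcSmooth V M j (klTowerStateS V M β U μ K t (j + 1)) = _
  rw [klTowerStateS_succ]
  exact (effAction_srcSmooth_comm (klStepCovD V M β μ K j) (klStepCovD_eq_zero_of_src β μ K j) _).symm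

/-- **`srcTrunc kk (SW-D_j) = map T_j (srcTrunc kk (SW-state j))`.** [cite: BenfattoGiulianiMastropietro2006, §2.9 (4.3)-(4.8)] -/
theorem srcTrunc_klTowerDSW_eq_map {β : ℝ} (hβ : β ≠ 0) (U μ : ℝ) (K : TrigPolyC4v) (t : ℝ) (j : ℕ) (kk : ℕ)
    (hZ : ∀ k, j = k + 1 → hubbardEffPartitionFnCT V M β U μ 0 K (klScale klE0 (k + 1)) ≠ 0) :
    srcTrunc ℂ (fun q : SrcLabel V M j => q.2 = 1) kk (klTowerDSW V M β U μ K t j) =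
      ExteriorAlgebra.map (Matrix.toLin' (klTowerTransfer V M β μ K j))
        (srcTrunc ℂ (fun q : SrcLabel V M (j - 1) => q.2 = 1) kk (klTowerStateSW V M β U μ K t j)) := by
  rw [map_toLin'_srcTrunc_comm _ (klTowerTransfer_copyDiagonal β μ K j) kk, map_klTowerTransfer_klTowerStateSW hβ U μ K t j hZ]

/-- **The truncated smoothed rescaled states obey the tower's recursion**:
`srcTrunc kk (SW-state (j+1)) = srcTrunc kk (effAction C⁺_j (map T_j (srcTrunc kk (SW-state j))))`. [cite: BenfattoGiulianiMastropietro2006, §2.9 (4.3)-(4.8)] -/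
theorem srcTrunc_klTowerStateSW_succ {β : ℝ} (hβ : β ≠ 0) (U μ : ℝ) (K : TrigPolyC4v) (t : ℝ) (j : ℕ) (kk : ℕ)
    (hZ : ∀ k, j = k + 1 → hubbardEffPartitionFnCT V M β U μ 0 K (klScale klE0 (k + 1)) ≠ 0)
    (hZj : hubbardEffPartitionFnCT V M β U μ 0 K (klScale klE0 (j + 1)) ≠ 0) :
    srcTrunc ℂ (fun q : SrcLabel V M j => q.2 = 1) kk (klTowerStateSW V M β U μ K t (j + 1)) =
      srcTrunc ℂ (fun q : SrcLabel V M j => q.2 = 1) kk (effAction ℂ (klStepCovD V M β μ K j)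
        (ExteriorAlgebra.map (Matrix.toLin' (klTowerTransfer V M β μ K j))
          (srcTrunc ℂ (fun q : SrcLabel V M (j - 1) => q.2 = 1) kk (klTowerStateSW V M β U μ K t j)))) := by
  have h0 : constPart ℂ (klTowerStateSW V M β U μ K t j) = 0 := by
    have hD := (klTowerDSW_parity β U μ K t j hZj).2
    rw [← map_klTowerTransfer_klTowerStateSW hβ U μ K t j hZ, constPart_map] at hD
    exact hD
  rw [klTowerStateSW_succ_eq_effAction_map hβ U μ K t j hZ]
  exact (srcTrunc_effAction_map_srcTrunc (klStepCovD V M β μ K j) (klStepCovD_eq_zero_of_src β μ K j) _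
    (klTowerTransfer_copyDiagonal β μ K j) kk h0).symm

section Package

variable {L b M : ℕ} [NeZero L] [NeZero (b * L)]

/-- **`SW-state_t = S_t (srcSmooth state)`** (the smoothing and the rescaling commute; the rescaled states are the rescalings of the states).
[cite: BenfattoGiulianiMastropietro2006, §2.9 (4.6)-(4.8)] -/
theorem klTowerStateSW_eq_srcScale_srcSmooth {V : ℕ} [NeZero V] (β U μ : ℝ) (K : TrigPolyC4v) (t : ℝ) (j : ℕ) :
    klTowerStateSW V M β U μ K t j = srcScale ℂ t (srcSmooth V M (j - 1) (klTowerState V M β U μ K j)) := by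
  rw [klTowerStateSW_eq, klTowerStateS_eq_srcScale, srcSmooth_srcScale_comm]

/-- **The smoothed rescaled truncated keyed defect decreases in `t ∈ [0,1]`**: `klKeyedDefectTSW … t ≤ klKeyedDefectTSW … 1` (every string is weighted by
`t^{#source legs} ≤ 1`). [cite: BenfattoGiulianiMastropietro2006, §2.9 (4.6)-(4.8)] -/
theorem klKeyedDefectTSW_le_one (β U μ : ℝ) (Kc Kf : TrigPolyC4v) {t : ℝ} (ht0 : 0 ≤ t) (ht1 : t ≤ 1) (j k : ℕ) (p : Fin k)
    (w : SrcLabel (b * L) M (j - 1)) :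
    klKeyedDefectTSW L b M β U μ Kc Kf t j k p w ≤ klKeyedDefectTSW L b M β U μ Kc Kf 1 j k p w := by
  rw [klKeyedDefectTSW_eq, klKeyedDefectTSW_eq, klTowerStateSW_eq_srcScale_srcSmooth, klTowerStateSW_eq_srcScale_srcSmooth,
    klTowerStateSW_eq_srcScale_srcSmooth, klTowerStateSW_eq_srcScale_srcSmooth, srcScale_one, srcScale_one,
    ← srcScale_srcTrunc_comm, ← srcScale_srcTrunc_comm]
  exact sum_filter_norm_keyed_kernel_srcScale_le (klBlockEquivD L b M (j - 1)) (fun y => by obtain ⟨x, s⟩ := y; rw [klBlockEquivD_apply]) ht0 ht1 _ _ k p w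

end Package

end Summit.HubbardSuperconductivity.HubbardSuperconductivity.Theorems.TwoVolumeSource

end
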